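import Summits.NavierStokesRegularity.NavierStokesRegularity.Theorems.RungBlowupCofinal.PrecessingLerayReduction
import Literature.Analysis.FluidPDE.PineauVicolRSSHolds
import HarnessLib

/-!
# On the precessing Leray line of K1, an exact profile (vanishing defect) with precession speed
# outside Pineau–Vicol's middle band is trivial — at every rung
# (route `AngularGalerkinLadder`, crux K1 `RungBlowupCofinal`; Negative lane)

Negative-lane bookkeeping for `stmt-NavierStokesRegularity-19959` (K1 of route №8), cell ns-blowup,
refuter5 (K5-72). Nothing here asserts a Theses declaration; no definition, no named fact.

The precessing-Leray reduction (`PrecessingLerayReduction.lean`, `isClassicalNSSolutionOn_pvAnsatz_forced`)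
turns a K1 candidate at rung `L` into a profile triple `(V, Q, G)` solving
`−ΔV + ½V + ½(y·∇)V + α·J₃V + (V·∇)V + ∇Q = G` with `V` smooth, divergence free, of Type-I decay
`‖V y‖ ≤ C/(‖y‖+1)`; the defect `G` must be co-band-limited and `V` band-limited. When the defect
VANISHES the ansatz `pvAnsatz α V` is an unforced classical Navier–Stokes solution on `t < 0` with the
Type-I bound `‖u(t,x)‖ ≤ C/(‖x‖ + √(−t))` — exactly the hypotheses of Pineau–Vicol's Liouville theorem
for rotated self-similar profiles (tree theorem `pineauVicol2026_rss_liouville_holds`, PROVED): for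
`|α| < α₁(C₀)` or `|α| > α₂(C₀)` the profile is zero. So an exact (`G ≡ 0`) nontrivial candidate on
this line can only precess at a speed inside the open middle band `[α₁, α₂]` — the Pineau–Vicol gap
(their Conjecture 1.1), where nothing is claimed here.

* `norm_pvAnsatz_le` — profile decay `C/(‖y‖+1)` ⇒ Type-I bound `C/(‖x‖+√(−t))` for the ansatz.
* `eq_zero_of_defect_eq_zero_offBand` — for every `C₀ > 0` there are `α₁, α₂ > 0` (Pineau–Vicol's)
  such that every triple with `C ≤ C₀`, `G ≡ 0` and `|α| < α₁ ∨ α₂ < |α|` has `V = 0`.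
* `defect_ne_zero_of_nontrivial_offBand` — contrapositive: off the band, every NONTRIVIAL candidate
  carries a non-zero defect, at every rung.

Companion of `PrecessingLerayAlphaZeroDefect.lean` (`α = 0`, Tsai). What this is NOT: nothing inside
the band; nothing about `¬RungBlowupCofinal`; the thresholds are Pineau–Vicol's existential ones (no
numerical value of `α` is certified either way).
[cite: PineauVicol2026, Theorem 1.4 (arXiv:2607.09619 p. 4)]
-/

noncomputable section

namespace Summit.NavierStokesRegularity.AngularGalerkinLadderPrecessingOffBandDefect

open Set Function MeasureTheory
open scoped Laplacian ContDiff
open Literature.Analysis Literature.Analysis.FluidPDE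
open Summit.NavierStokesRegularity.FluidComputer
open Summit.NavierStokesRegularity.FluidComputer.AngularLadder
open Summit.NavierStokesRegularity.AngularGalerkinLadderPrecessingReduction

/-- **Type-I bound of the precessing ansatz from the profile's decay**: `‖V y‖ ≤ C/(‖y‖+1)` gives
`‖pvAnsatz α V (t, x)‖ ≤ C/(‖x‖ + √(−t))` for `t < 0` (rotations are isometries; `y = R x/√(−t)`). [folklore] -/
theorem norm_pvAnsatz_le {α C : ℝ} {V : EuclideanSpace ℝ (Fin 3) → EuclideanSpace ℝ (Fin 3)}
    (hdec : ∀ y, ‖V y‖ ≤ C / (‖y‖ + 1)) {t : ℝ} (ht : t < 0) (x : EuclideanSpace ℝ (Fin 3)) :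
    ‖pvAnsatz α (fun y _ => V y) t x‖ ≤ C / (‖x‖ + Real.sqrt (-t)) := by
  have hst : 0 < Real.sqrt (-t) := Real.sqrt_pos.2 (neg_pos.2 ht)
  have hrot : ∀ (θ : ℝ) (v : EuclideanSpace ℝ (Fin 3)), ‖rotZ θ v‖ = ‖v‖ := fun θ v => by
    rw [← rotZLIE_apply]; exact (rotZLIE θ).norm_map v
  set w := rotZ (-(α * -Real.log (-t))) ((Real.sqrt (-t))⁻¹ • x) with hw_def
  have hw : ‖w‖ = (Real.sqrt (-t))⁻¹ * ‖x‖ := by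
    rw [hw_def, hrot, norm_smul, norm_inv, Real.norm_of_nonneg hst.le]
  have h1 : ‖V w‖ ≤ C / ((Real.sqrt (-t))⁻¹ * ‖x‖ + 1) := hw ▸ hdec w
  have hval : pvAnsatz α (fun y _ => V y) t x = (Real.sqrt (-t))⁻¹ • rotZ (α * -Real.log (-t)) (V w) :=
    rfl
  rw [hval, norm_smul, norm_inv, Real.norm_of_nonneg hst.le, hrot]
  calc (Real.sqrt (-t))⁻¹ * ‖V w‖
      ≤ (Real.sqrt (-t))⁻¹ * (C / ((Real.sqrt (-t))⁻¹ * ‖x‖ + 1)) :=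
        mul_le_mul_of_nonneg_left h1 (inv_nonneg.2 hst.le)
    _ = C / (‖x‖ + Real.sqrt (-t)) := by
        field_simp

/-- **No defect and off-band speed ⇒ no profile.** For every Type-I constant `C₀ > 0` there are
`α₁, α₂ > 0` (Pineau–Vicol's thresholds) such that: if `(V, Q)` are smooth, `V` is divergence free
with `‖V y‖ ≤ C/(‖y‖+1)`, `C ≤ C₀`, the rotating steady Leray system of the precessing line holds with
defect `G ≡ 0` (`ν = 1`, rate `½`), and `|α| < α₁` or `α₂ < |α|`, then `V = 0`.
[cite: PineauVicol2026, Theorem 1.4 (arXiv:2607.09619 p. 4)] -/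
theorem eq_zero_of_defect_eq_zero_offBand {C₀ : ℝ} (hC₀ : 0 < C₀) :
    ∃ α₁ α₂ : ℝ, 0 < α₁ ∧ 0 < α₂ ∧
      ∀ {α C : ℝ} {V G : EuclideanSpace ℝ (Fin 3) → EuclideanSpace ℝ (Fin 3)}
        {Q : EuclideanSpace ℝ (Fin 3) → ℝ}, C ≤ C₀ → ContDiff ℝ ∞ V → ContDiff ℝ ∞ Q →
        (∀ z, -((1 : ℝ) • (Δ V) z) + (1 / 2 : ℝ) • V z + (1 / 2 : ℝ) • fderiv ℝ V z z +
          α • angGen 2 V z + convect V V z + gradient Q z = G z) →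
        (∀ z, G z = 0) → VectorCalculus.IsDivFree V → (∀ y, ‖V y‖ ≤ C / (‖y‖ + 1)) →
        (|α| < α₁ ∨ α₂ < |α|) → V = 0 := by
  obtain ⟨α₁, α₂, hα₁, hα₂, hPV⟩ := pineauVicol2026_rss_liouville_holds C₀ hC₀
  refine ⟨α₁, α₂, hα₁, hα₂, ?_⟩
  intro α C V G Q hC hV hQ heq hG hdiv hdec hband
  have hcl := isClassicalNSSolutionOn_pvAnsatz_forced (ν := 1) (α := α) hV hQ heq hdiv
  have hrot0 : ∀ θ : ℝ, rotZ θ (0 : EuclideanSpace ℝ (Fin 3)) = 0 := fun θ => by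
    rw [← rotZL_apply, map_zero]
  have hcl0 : IsClassicalNSSolutionOn (Iio 0) 1 0 (pvAnsatz α fun y _ => V y)
      (fun t x => (-t)⁻¹ * Q (rotZ (-(α * -Real.log (-t))) ((Real.sqrt (-t))⁻¹ • x))) := by
    convert hcl using 2
    funext x
    simp [hG, hrot0]
  have hcl' := hcl0.mono Ico_subset_Iio_self (uniqueDiffOn_Ico (-1) 0)
  refine hPV α _ _ V hcl' (fun t ht x => ?_) (hV.of_le (WithTop.coe_le_coe.mpr le_top))
    (fun t _ x => rfl) hband
  have hpos : 0 < ‖x‖ + Real.sqrt (-t) :=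
    add_pos_of_nonneg_of_pos (norm_nonneg _) (Real.sqrt_pos.2 (neg_pos.2 ht.2))
  exact (norm_pvAnsatz_le hdec ht.2 x).trans (div_le_div_of_nonneg_right hC hpos.le)

/-- **Contrapositive: off the band, every nontrivial exact candidate is impossible — a nontrivial
candidate with `|α| < α₁ ∨ α₂ < |α|` carries a non-zero defect.** [cite: PineauVicol2026, Theorem 1.4] -/
theorem defect_ne_zero_of_nontrivial_offBand {C₀ : ℝ} (hC₀ : 0 < C₀) :
    ∃ α₁ α₂ : ℝ, 0 < α₁ ∧ 0 < α₂ ∧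
      ∀ {α C : ℝ} {V G : EuclideanSpace ℝ (Fin 3) → EuclideanSpace ℝ (Fin 3)}
        {Q : EuclideanSpace ℝ (Fin 3) → ℝ}, C ≤ C₀ → ContDiff ℝ ∞ V → ContDiff ℝ ∞ Q →
        (∀ z, -((1 : ℝ) • (Δ V) z) + (1 / 2 : ℝ) • V z + (1 / 2 : ℝ) • fderiv ℝ V z z +
          α • angGen 2 V z + convect V V z + gradient Q z = G z) →
        VectorCalculus.IsDivFree V → (∀ y, ‖V y‖ ≤ C / (‖y‖ + 1)) →
        (|α| < α₁ ∨ α₂ < |α|) → (∃ y, V y ≠ 0) → ∃ z, G z ≠ 0 := by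
  obtain ⟨α₁, α₂, hα₁, hα₂, h⟩ := eq_zero_of_defect_eq_zero_offBand hC₀
  refine ⟨α₁, α₂, hα₁, hα₂, ?_⟩
  intro α C V G Q hC hV hQ heq hdiv hdec hband hne
  by_contra hG
  push Not at hG
  obtain ⟨y, hy⟩ := hne
  exact hy (by rw [h hC hV hQ heq hG hdiv hdec hband]; rfl)

end Summit.NavierStokesRegularity.AngularGalerkinLadderPrecessingOffBandDefect

end
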